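import Literature.NumberTheory.GaloisRepresentations.GaloisCohomologyUnitsInflationCocycle
import Literature.NumberTheory.GaloisRepresentations.IdeleLocalInvariantsCanonical
import Literature.NumberTheory.GaloisRepresentations.RelativeBrauerLocalInvariants
import Literature.NumberTheory.GaloisRepresentations.BrauerGroupCocycles
import HarnessLib

/-!
# The local invariant of a relative Brauer class at a finite place, read on the idèles, IS the invariant
# of the localised inflated class (Tate, C–F VII §7.2–§7.3 with Serre, *Local Fields* XIII §3; XI §2 Prop. 1)

Topic `NumberTheory/GaloisRepresentations`; namespace `Literature.NumberTheory.GaloisRepresentations.IdeleCohomology`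
(continuing door-c5's `IdeleLocalInvariants*`: `localInvAt w : H²(Gal(E/F), J_E) →+ ℚ/ℤ`,
`brauerToIdele : H²(Gal(E/F), Eˣ) ⟶ H²(Gal(E/F), J_E)`).  Definitions with bodies (two small `Rep`
morphisms) and theorems; NO named fact, no `sorry`, no notation, no global instance — one LOCAL instance attribute
(`-- WORDING-FIX (2026-08-28, door-c6 g13; referee N-g52-3): the header now declares this local instance attribute.
attribute [local instance] absoluteGaloisGroup_compactSpace`, the tree's theorem, needed to form continuous `2`-cocycle
classes; no override); number fields in `Type`.

THE DICTIONARY.  Let `E/F` be a finite Galois extension of number fields, `v` a finite place of `F`, `w ∣ v`,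
`β ∈ Br(E/F) = H²(Gal(E/F), Eˣ)`.  Door-c5's invariant of `β` at `v` is, by construction,
`inv_{E_w/F_v}` (door-c6 g10's `layerInv F_v E_w = inv_{F_v} ∘ inf_{E_w}`, THE invariant map of the local field
`F_v` on `Br(F_v) = H²(F_v, F̄_vˣ)`) of the component of `β` in `H²(Gal(E_w/F_v), E_wˣ)` obtained through the
semi-local Shapiro isomorphism — which is the restriction of `β` to the decomposition group `G_w ≅ Gal(E_w/F_v)`
followed by `E ⊆ E_w` (`shapiro_placeProj_brauerToIdele`, from door-c5's `Sh_w = res + π_w`).  On the other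
hand the tree's Brauer group `Br(F) = H²(F, F̄ˣ)` (absolute Galois cohomology) receives `β` by inflation
(`unitsAbsInfTwo F E`, door-c6 g9/g12) and localises to `Br(F_v)` by restriction along `Γ_{F_v} → Γ_F` with
`F̄ → F̄_v` (any standard units morphism `φ`, `exists_unitsHom`).  **Theorem
`localInvAt_brauerToIdele_eq_brauerInvariantEquiv`**:

  `localInvAt w (brauerToIdele β) = inv_{F_v} (loc_v (inf β))`.

Proof: both routes `H²(Gal(E/F), Eˣ) → H²(Γ_{F_v}, F̄_vˣ)` are pulls along compatible pairs attached to two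
`F`-embeddings `E → F̄_v` (`F̄ → F̄_v ∘ ι_E` and `ι_{E_w} ∘ (E ⊆ E_w)`), which differ by an element of
`Gal(E/F)` since `E/F` is normal (Mathlib `AlgHom.restrictNormal'`); conjugate pairs induce the same map on
`H²` (`CompatiblePair.twoCocycleClass_pull_eq_of_ringHom_eq_comp`, Serre *Local Fields* VII §5 Prop. 3).
This is the compatibility "the invariants of `H²(G, J_L)` are those of local class field theory"
(Tate C–F VII §7.3 Cor. 7.4 (b) with §11.2; Serre *Local Fields* XI §2 Prop. 1: `inv` commutes with the
passage to completions) that lets the tree's ABSOLUTE reciprocity law (`Σ_v inv_v = 0` on `H²(Γ_F, μₙ)`,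
`PoitouTateNumberField`) descend to door-c5's finite-layer `inv = Σ_v inv_v` on `H²(G, J_E)` (next file).

* §1 `decompIncl w : Gal(E_w/F_v) →* Gal(E/F)`, `unitsToPlaceHom w : Res (Eˣ) ⟶ E_wˣ`,
  **`shapiro_placeProj_brauerToIdele`**: `Sh^{Aut}_w (π_v (ι β)) = Hⁿ(decompIncl w, E ⊆ E_w) β`.
* §2 `localInvAt_brauerToIdele_eq_pull` (door-c5's invariant as `inv_{F_v}` of ONE pulled-back cocycle),
  `exists_algEquiv_localEmbedding_eq` (the element of `Gal(E/F)` relating the two embeddings `E → F̄_v`),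
  **`localInvAt_brauerToIdele_eq_brauerInvariantEquiv`** (the dictionary), and its corollary
  `localInv_brauerToIdele_eq_brauerInvariantEquiv` for door-c5's `localInv E v` (chosen place).

HONEST FRAMING: bookkeeping between two dialects of the tree; no case of BSD / Poitou–Tate is proved.
Written for Route A of crux `AnticycControlAdditiveK` (cell bsd-schneider), (A4)/(A6) of FINDING-door-c6-g11.

## References
* J. W. S. Cassels, A. Fröhlich (eds.), *Algebraic Number Theory* (1967), Ch. VII (J. Tate) §7.2–§7.3
  (Cor. 7.4 (b)), §11.2. [CasselsFrohlichANT1967]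
* J.-P. Serre, *Local Fields*, GTM 67 (1979), Ch. VII §5 Prop. 3, Ch. XI §2 Prop. 1, Ch. XIII §3.
  [SerreLocalFields1979]
* J.-P. Serre, *Galois Cohomology* (1997), Ch. I §2.4, Ch. II §6.1. [SerreGaloisCohomology1997]
-/

noncomputable section

open NumberField IsDedekindDomain CategoryTheory groupCohomology Function Field
open Literature.NumberTheory.Automorphic

namespace Literature.NumberTheory.GaloisRepresentations

namespace IdeleCohomology

open SemiLocal Literature.Algebra.Homology DiscreteGaloisModule
open Literature.AnabelianGeometry.AbsoluteAnabelian.Prop121vii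

-- Explicit `2`-cocycle classes need `LocallyCompactSpace Γ`; the tree's theorem is the only source of it for
-- `Γ_{F_v}`.  Local to this file, no override (as in `PoitouTate.lean`).
attribute [local instance] absoluteGaloisGroup_compactSpace

variable {F : Type} [Field F] [NumberField F] {E : Type} [Field E] [NumberField E] [Algebra F E] [IsGalois F E]
variable {v : HeightOneSpectrum (𝓞 F)}

/-! ## §1. The Shapiro component of a principal class is its restriction to the decomposition group -/

/-- **`Gal(E_w/F_v) ↪ Gal(E/F)`**: the inverse of door-c5's `decompMulEquiv w : G_w ≃* Gal(E_w/F_v)` followed by the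
inclusion of the decomposition group. [cite: CasselsFrohlichANT1967, Ch. VII §1.1] -/
def decompIncl (w : Place F E v) :
    (((w : HeightOneSpectrum (𝓞 E)).adicCompletion E) ≃ₐ[v.adicCompletion F]
        ((w : HeightOneSpectrum (𝓞 E)).adicCompletion E)) →* (E ≃ₐ[F] E) :=
  (MulAction.stabilizer (E ≃ₐ[F] E) w).subtype.comp (decompMulEquiv w).symm.toMonoidHom

/-- `decompIncl w g` acts on `E ⊆ E_w` as `g`. [cite: CasselsFrohlichANT1967, Ch. VII §1.1] -/
theorem coe_decompIncl_apply (w : Place F E v)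
    (g : ((w : HeightOneSpectrum (𝓞 E)).adicCompletion E) ≃ₐ[v.adicCompletion F]
        ((w : HeightOneSpectrum (𝓞 E)).adicCompletion E)) (x : E) :
    ((decompIncl w g x : E) : (w : HeightOneSpectrum (𝓞 E)).adicCompletion E) =
      g (x : (w : HeightOneSpectrum (𝓞 E)).adicCompletion E) := by
  have h := decompAlgEquiv_coe w ((decompMulEquiv w).symm g) x
  rw [← decompMulEquiv_apply, MulEquiv.apply_symm_apply] at h
  exact h.symm

/-- **`Eˣ → E_wˣ` as a morphism `Res_{decompIncl w} (Eˣ) ⟶ E_wˣ`** of `Gal(E_w/F_v)`-modules.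
[cite: CasselsFrohlichANT1967, Ch. VII §1.1][cite: SerreGaloisCohomology1997, Ch. I §2.4] -/
def unitsToPlaceHom (w : Place F E v) :
    Rep.res (decompIncl w) (Rep.ofAlgebraAutOnUnits F E) ⟶
      Rep.ofAlgebraAutOnUnits (v.adicCompletion F) ((w : HeightOneSpectrum (𝓞 E)).adicCompletion E) :=
  Rep.ofHom ⟨(MonoidHom.toAdditive (Units.map (algebraMap E ((w : HeightOneSpectrum (𝓞 E)).adicCompletion E) :
      E →* (w : HeightOneSpectrum (𝓞 E)).adicCompletion E))).toIntLinearMap, fun g => by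
    apply LinearMap.ext
    intro x
    refine Additive.toMul.injective (Units.ext ?_)
    exact coe_decompIncl_apply w g ((Additive.toMul x : Eˣ) : E)⟩

/-- Unfolding `unitsToPlaceHom` on a unit. [cite: CasselsFrohlichANT1967, Ch. VII §1.1] -/
theorem unitsToPlaceHom_hom_ofMul (w : Place F E v) (u : Eˣ) :
    (unitsToPlaceHom w).hom (Additive.ofMul u) =
      Additive.ofMul (Units.map (algebraMap E ((w : HeightOneSpectrum (𝓞 E)).adicCompletion E) :
        E →* (w : HeightOneSpectrum (𝓞 E)).adicCompletion E) u) := rfl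

/-- **The semi-local Shapiro isomorphism on a principal class is restriction to the decomposition group**:
`Sh^{Aut}_w (Hⁿ(π_v) (Hⁿ(Eˣ → J_E) β)) = Hⁿ(decompIncl w, Eˣ ⊆ E_wˣ) β` (door-c5's `Sh_w = Hⁿ(G_w ↪ G, π_w)` and
`(π_w ∘ π_v)(x) = x ∈ E_w` for `x ∈ E`). [cite: CasselsFrohlichANT1967, Ch. VII §7.2] -/
theorem shapiro_placeProj_principal (w : Place F E v) (n : ℕ) :
    groupCohomology.map (MonoidHom.id _) (IdeleClassGroup.principalRepHom F E) n ≫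
        groupCohomology.map (MonoidHom.id _) (placeProj (E := E) v) n ≫ (groupCohomologyUnitsRepIsoAut w n).hom =
      groupCohomology.map (decompIncl w) (unitsToPlaceHom w) n := by
  rw [groupCohomologyUnitsRepIsoAut, Iso.trans_hom, groupCohomologyUnitsRepIso_hom_eq, groupCohomologyLocalUnitsRepIso,
    groupCohomology.mapIso_hom, ← Category.assoc, ← groupCohomology.map_id_comp, ← Category.assoc,
    ← groupCohomology.map_comp, ← groupCohomology.map_comp]
  refine map_congr' (MonoidHom.ext fun _ => rfl) _ _ (fun x => ?_) n
  refine Additive.toMul.injective (Units.ext ?_)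
  rfl

/-- Element form of `shapiro_placeProj_principal` in degree `2`, for `brauerToIdele`.
[cite: CasselsFrohlichANT1967, Ch. VII §7.2] -/
theorem shapiro_placeProj_brauerToIdele (w : Place F E v) (β : groupCohomology (Rep.ofAlgebraAutOnUnits F E) 2) :
    (groupCohomologyUnitsRepIsoAut w 2).hom (groupCohomology.map (MonoidHom.id (E ≃ₐ[F] E)) (placeProj v) 2
        (brauerToIdele F E β)) =
      groupCohomology.map (decompIncl w) (unitsToPlaceHom w) 2 β := by
  have h := congrArg (fun T => (ConcreteCategory.hom T) β) (shapiro_placeProj_principal w 2)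
  simpa only [brauerToIdele_apply, ModuleCat.hom_comp, LinearMap.coe_comp, Function.comp_apply] using h

/-! ## §2. The dictionary -/

/-- `F_v` has characteristic `0`. [cite: CasselsFrohlichANT1967, Ch. II §10] -/
private theorem charZero_base (v : HeightOneSpectrum (𝓞 F)) : CharZero (v.adicCompletion F) :=
  charZero_adicCompletion v

/-- The local pair `(Γ_{F_v}, F̄_vˣ) → (Gal(E/F), Eˣ)` through the completion `E_w`: door-c6's `absUnitsPair F_v E_w`
composed with `(decompIncl w, Eˣ ⊆ E_wˣ)`; module component `u ↦ ι_{E_w}(u)`.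
[cite: SerreGaloisCohomology1997, Ch. I §2.4][cite: CasselsFrohlichANT1967, Ch. VII §7.2] -/
def localPair (w : Place F E v) :
    CompatiblePair (Rep.ofAlgebraAutOnUnits F E) (units (v.adicCompletion F)).toTopRep :=
  haveI := charZero_base v
  haveI := finiteDimensional_place (K := F) w
  haveI := isGalois_place (F := F) w
  (absUnitsPair (v.adicCompletion F) ((w : HeightOneSpectrum (𝓞 E)).adicCompletion E)).compMap
    (decompIncl w) (unitsToPlaceHom w)

/-- The module component of `localPair w`: `u ↦ ι_{E_w}(u)` for `ι_{E_w} = embeddingToAbs F_v E_w ∘ (E ⊆ E_w)`.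
[cite: SerreGaloisCohomology1997, Ch. I §2.4] -/
theorem localPair_φ_ofMul (w : Place F E v) (u : Eˣ) :
    (localPair w).φ (Additive.ofMul u) =
      (haveI := finiteDimensional_place (K := F) w; UnitsCarrier.ofUnits
        (Units.map
          (((embeddingToAbs (v.adicCompletion F) ((w : HeightOneSpectrum (𝓞 E)).adicCompletion E)) :
              (w : HeightOneSpectrum (𝓞 E)).adicCompletion E →+* AlgebraicClosure (v.adicCompletion F)).comp
            (algebraMap E ((w : HeightOneSpectrum (𝓞 E)).adicCompletion E)) :
              E →* AlgebraicClosure (v.adicCompletion F))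
          u)) := by
  haveI := charZero_base v
  haveI := finiteDimensional_place (K := F) w
  haveI := isGalois_place (F := F) w
  change (absUnitsPair (v.adicCompletion F) ((w : HeightOneSpectrum (𝓞 E)).adicCompletion E)).φ
    ((unitsToPlaceHom w).hom (Additive.ofMul u)) = _
  rw [unitsToPlaceHom_hom_ofMul]
  exact (absUnitsPair_φ_ofMul _ _ _).trans (congrArg UnitsCarrier.ofUnits (Units.ext rfl))

/-- **Door-c5's invariant at `w` of a relative Brauer class is `inv_{F_v}` of ONE pulled-back cocycle**:
`localInvAt w (brauerToIdele [b]) = inv_{F_v} [pull_{localPair w} b]`.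
[cite: CasselsFrohlichANT1967, Ch. VII §7.3 Cor. 7.4 (b)][cite: SerreLocalFields1979, Ch. XIII §3] -/
theorem localInvAt_brauerToIdele_eq_pull (w : Place F E v) (b : cocycles₂ (Rep.ofAlgebraAutOnUnits F E)) :
    localInvAt w (brauerToIdele F E (H2π _ b)) =
      (haveI := charZero_base v; brauerInvariantEquiv (v.adicCompletion F)
        (twoCocycleClass (units (v.adicCompletion F)).toTopRep ((localPair w).pull b))) := by
  haveI := charZero_base v
  haveI := finiteDimensional_place (K := F) w
  haveI := isGalois_place (F := F) w
  rw [localInvAt_apply, shapiro_placeProj_brauerToIdele, H2π_comp_map_apply,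
    layerInv_eq_brauerInvariantEquiv_unitsAbsInfTwo, unitsAbsInfTwo_H2π, CompatiblePair.pull_mapCocycles₂]
  rfl

/-- **The two `F`-embeddings `E → F̄_v` — `F̄ → F̄_v ∘ ι_E` (global) and `ι_{E_w} ∘ (E ⊆ E_w)` (through the
completion) — differ by an element of `Gal(E/F)`** (`E/F` is normal; Mathlib `AlgHom.restrictNormal'`).
[cite: SerreLocalFields1979, Ch. VII §5 Prop. 3][cite: CasselsFrohlichANT1967, Ch. VII §1.1] -/
theorem exists_algEquiv_localEmbedding_eq (w : Place F E v) :
    ∃ σ : E ≃ₐ[F] E, ∀ x : E,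
      (haveI := finiteDimensional_place (K := F) w;
        embeddingToAbs (v.adicCompletion F) ((w : HeightOneSpectrum (𝓞 E)).adicCompletion E)
          (x : (w : HeightOneSpectrum (𝓞 E)).adicCompletion E)) =
        absClosureEmbedding F (v.adicCompletion F) (embeddingToAbs F E (σ x)) := by
  haveI := finiteDimensional_place (K := F) w
  -- the two `F`-algebra maps `E → F̄_v`
  let j₁ : E →ₐ[F] AlgebraicClosure (v.adicCompletion F) :=
    (absClosureEmbedding F (v.adicCompletion F)).comp (embeddingToAbs F E)
  have hcoe : ∀ a : F, ((algebraMap F E a : E) : (w : HeightOneSpectrum (𝓞 E)).adicCompletion E) =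
      algebraMap (v.adicCompletion F) ((w : HeightOneSpectrum (𝓞 E)).adicCompletion E)
        (algebraMap F (v.adicCompletion F) a) := fun a => by
    rw [algebraMap_place_eq]
    exact (adicCompletionOfLiesOver_coe F E v (w : HeightOneSpectrum (𝓞 E)) a).symm
  let j₂ : E →ₐ[F] AlgebraicClosure (v.adicCompletion F) :=
    { toRingHom := ((embeddingToAbs (v.adicCompletion F) ((w : HeightOneSpectrum (𝓞 E)).adicCompletion E)) :
          (w : HeightOneSpectrum (𝓞 E)).adicCompletion E →+* AlgebraicClosure (v.adicCompletion F)).comp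
        (algebraMap E ((w : HeightOneSpectrum (𝓞 E)).adicCompletion E))
      commutes' := fun a => by
        change embeddingToAbs (v.adicCompletion F) ((w : HeightOneSpectrum (𝓞 E)).adicCompletion E)
          (algebraMap E ((w : HeightOneSpectrum (𝓞 E)).adicCompletion E) (algebraMap F E a)) = _
        have h1 : algebraMap E ((w : HeightOneSpectrum (𝓞 E)).adicCompletion E) (algebraMap F E a) =
            algebraMap (v.adicCompletion F) ((w : HeightOneSpectrum (𝓞 E)).adicCompletion E)
              (algebraMap F (v.adicCompletion F) a) := hcoe a
        rw [h1, AlgHom.commutes, ← IsScalarTower.algebraMap_apply] }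
  letI : Algebra E (AlgebraicClosure (v.adicCompletion F)) := (j₁ : E →+* _).toAlgebra
  haveI : IsScalarTower F E (AlgebraicClosure (v.adicCompletion F)) :=
    IsScalarTower.of_algebraMap_eq fun a => (j₁.commutes a).symm
  refine ⟨j₂.restrictNormal' E, fun x => ?_⟩
  have h := AlgHom.restrictNormal_commutes j₂ E x
  rw [Algebra.algebraMap_self, RingHom.id_apply] at h
  exact h.symm

/-- **THE DICTIONARY.**  For `β ∈ Br(E/F) = H²(Gal(E/F), Eˣ)`, a finite place `v` of `F` and `w ∣ v`:
door-c5's idèle-side local invariant of `β` (component at `v`, Shapiro, `inv_{E_w/F_v}`) equals THE invariant map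
of `F_v` on the localisation at `v` of the inflation of `β` to `Br(F) = H²(F, F̄ˣ)` — for every standard units
morphism `φ : res (F̄ˣ) ⟶ F̄_vˣ` (`u ↦ ι(u)`, `exists_unitsHom`).
[cite: CasselsFrohlichANT1967, Ch. VII §7.3 Cor. 7.4 (b)][cite: SerreLocalFields1979, Ch. XI §2 Prop. 1] -/
theorem localInvAt_brauerToIdele_eq_brauerInvariantEquiv (w : Place F E v)
    (φ : TopRep.res ((absGaloisRestrict F (v.adicCompletion F) :
        absoluteGaloisGroup (v.adicCompletion F) →ₜ* absoluteGaloisGroup F) :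
          absoluteGaloisGroup (v.adicCompletion F) →* absoluteGaloisGroup F) (units F).toTopRep ⟶
        (units (v.adicCompletion F)).toTopRep)
    (hφ : ∀ u : (AlgebraicClosure F)ˣ, φ.hom (UnitsCarrier.ofUnits u) =
      UnitsCarrier.ofUnits (Units.map (absClosureEmbedding F (v.adicCompletion F) :
        AlgebraicClosure F →* AlgebraicClosure (v.adicCompletion F)) u))
    (β : groupCohomology (Rep.ofAlgebraAutOnUnits F E) 2) :
    localInvAt w (brauerToIdele F E β) =
      (haveI := charZero_base v; brauerInvariantEquiv (v.adicCompletion F)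
        ((ContinuousCohomology.map (absGaloisRestrict F (v.adicCompletion F)) φ 2).hom (unitsAbsInfTwo F E β))) := by
  haveI := charZero_base v
  haveI := finiteDimensional_place (K := F) w
  induction β using H2_induction_on with
  | h b =>
  rw [localInvAt_brauerToIdele_eq_pull, map_unitsAbsInfTwo_H2π]
  obtain ⟨σ, hσ⟩ := exists_algEquiv_localEmbedding_eq (F := F) (E := E) w
  refine congrArg (brauerInvariantEquiv (v.adicCompletion F)) ?_
  exact CompatiblePair.twoCocycleClass_pull_eq_of_ringHom_eq_comp (v.adicCompletion F)
    ((absUnitsPair F E).pullback (absGaloisRestrict F (v.adicCompletion F)) φ) (localPair w)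
    (((absClosureEmbedding F (v.adicCompletion F) : AlgebraicClosure F →+* AlgebraicClosure (v.adicCompletion F)).comp
      (embeddingToAbs F E : E →+* AlgebraicClosure F)))
    (((embeddingToAbs (v.adicCompletion F) ((w : HeightOneSpectrum (𝓞 E)).adicCompletion E)) :
        (w : HeightOneSpectrum (𝓞 E)).adicCompletion E →+* AlgebraicClosure (v.adicCompletion F)).comp
      (algebraMap E ((w : HeightOneSpectrum (𝓞 E)).adicCompletion E)))
    σ (pullback_absUnitsPair_φ_ofMul F E (v.adicCompletion F) φ hφ) (localPair_φ_ofMul w) hσ b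

/-- The dictionary for door-c5's `localInv E v` (read at the chosen place above `v`).
[cite: CasselsFrohlichANT1967, Ch. VII §7.3 Cor. 7.4 (b)][cite: SerreLocalFields1979, Ch. XI §2 Prop. 1] -/
theorem localInv_brauerToIdele_eq_brauerInvariantEquiv (v : HeightOneSpectrum (𝓞 F))
    (φ : TopRep.res ((absGaloisRestrict F (v.adicCompletion F) :
        absoluteGaloisGroup (v.adicCompletion F) →ₜ* absoluteGaloisGroup F) :
          absoluteGaloisGroup (v.adicCompletion F) →* absoluteGaloisGroup F) (units F).toTopRep ⟶
        (units (v.adicCompletion F)).toTopRep)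
    (hφ : ∀ u : (AlgebraicClosure F)ˣ, φ.hom (UnitsCarrier.ofUnits u) =
      UnitsCarrier.ofUnits (Units.map (absClosureEmbedding F (v.adicCompletion F) :
        AlgebraicClosure F →* AlgebraicClosure (v.adicCompletion F)) u))
    (β : groupCohomology (Rep.ofAlgebraAutOnUnits F E) 2) :
    localInv E v (brauerToIdele F E β) =
      (haveI := charZero_base v; brauerInvariantEquiv (v.adicCompletion F)
        ((ContinuousCohomology.map (absGaloisRestrict F (v.adicCompletion F)) φ 2).hom (unitsAbsInfTwo F E β))) :=
  localInvAt_brauerToIdele_eq_brauerInvariantEquiv (chosenPlace (E := E) v) φ hφ β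

end IdeleCohomology

end Literature.NumberTheory.GaloisRepresentations

end
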